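import Mathlib
import HarnessLib
import Summits.NavierStokesRegularity.NavierStokesRegularity.Theorems.PoloidalWindowDoorLrcModEntireJetCertPsatzElimI
import Summits.NavierStokesRegularity.NavierStokesRegularity.Theorems.PoloidalWindowDoorLrcModEntireJetCertPsatzElimHStage

/-!
# Jet-certificate checker — STAGED replay for the PRE-TESTED content-removal variant (`…JetCertPsatzElimI`)

Cell `ns-wall-extremal`, arm C (PREREG-WALL-1 §C, C1b all-tilt cells (4,4) / (6,2) of ≥ 120 k terms), seat ns-crc-p1 g6 (Lean-certificate hand,
successor of g5; staging design of ns-wall-eng-6 g2's `…JetCertPsatzElimHStage`), 2026-08-28.  `--supports stmt-NavierStokesRegularity-19708`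
(instrument).  Generic; no Navier–Stokes content.

WHY: `…JetCertPsatzElimHStage` cuts the one-shot replay `killCheckH` of a large all-tilt cell into stages that each fit the gate's evaluation budget;
`…JetCertPsatzElimI` replays the SAME transcript nodes with the divisibility pre-test `quadDivisible` gating every (still verified) division by
`1 + X_g²` — measured ≈ 2.4× cheaper on the all-tilt cells, where most touched laws are not divisible and `…ElimG/H` peel every layer before failing.
This file is the staged replay of THAT variant, word for word the construction of `…ElimHStage` with `substStrip ↦ substStripI` and
`etreeCheckH ↦ etreeCheckI`: fewer, longer stages for the same cell, hence fewer explicit intermediate states to land.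

* `runI` (replay a list of `HStep`s: the `elim`/`force` branches of `etreeCheckI`, verbatim), `pointDatum_runI`;
* `stageCheckI` (+ **`pointDatum_of_stageCheckI`**), reusing `HStep`, `polyListEq`, `pointDatum_of_polyListEq` of `…ElimHStage`;
* **`kills_of_stagesI`**: a chain `PointDatum (hyps, pins ++ [Σ X_j²]) → PointDatum (h_K, p_K)` + `etreeCheckI … h_K p_K [] [] t` ⇒ `Kills n hyps pins [] [] J`
  (the statement of `kills_of_killCheckI` / `kills_of_killCheckH`, by the same argument); stages of the two variants may be MIXED in one chain, since
  both conclude `PointDatum` of explicit states;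
* self-test (`decide +kernel`): the toy transcript of `…JetCertPsatzElimH`, cut into two stages, replayed in the pre-tested variant.

WHAT THIS IS NOT: not a claim about Navier–Stokes, not a certificate. [folklore]
-/

noncomputable section

-- the summit and its single sub-problem share the name (CONVENTIONS §1), as in every Theorems file
set_option linter.dupNamespace false

namespace Summit.NavierStokesRegularity.NavierStokesRegularity.Theorems.PoloidalWindowDoorLrcModEntireJetCertPsatzElimIStage

open _root_.Topology _root_.Filter Set
open Literature.Analysis.ValidatedNumerics Literature.Analysis.ValidatedNumerics.QMvPoly
open Literature.Analysis.Calculus.MvPoly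
open Summit.NavierStokesRegularity.NavierStokesRegularity.Theorems.PoloidalWindowDoorLrcModEntireJetCertDefs
open Summit.NavierStokesRegularity.NavierStokesRegularity.Theorems.PoloidalWindowDoorLrcModEntireJetCertTree
open Summit.NavierStokesRegularity.NavierStokesRegularity.Theorems.PoloidalWindowDoorLrcModEntireJetCertFast2
open Summit.NavierStokesRegularity.NavierStokesRegularity.Theorems.PoloidalWindowDoorLrcModEntireJetCertGauge
open Summit.NavierStokesRegularity.NavierStokesRegularity.Theorems.PoloidalWindowDoorLrcModEntireJetCertPsatz
open Summit.NavierStokesRegularity.NavierStokesRegularity.Theorems.PoloidalWindowDoorLrcModEntireJetCertPsatzSubst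
open Summit.NavierStokesRegularity.NavierStokesRegularity.Theorems.PoloidalWindowDoorLrcModEntireJetCertPsatzElim
open Summit.NavierStokesRegularity.NavierStokesRegularity.Theorems.PoloidalWindowDoorLrcModEntireJetCertPsatzElimN
open Summit.NavierStokesRegularity.NavierStokesRegularity.Theorems.PoloidalWindowDoorLrcModEntireJetCertPsatzElimG
open Summit.NavierStokesRegularity.NavierStokesRegularity.Theorems.PoloidalWindowDoorLrcModEntireJetCertPsatzElimH
open Summit.NavierStokesRegularity.NavierStokesRegularity.Theorems.PoloidalWindowDoorLrcModEntireJetCertPsatzElimI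
open Summit.NavierStokesRegularity.NavierStokesRegularity.Theorems.PoloidalWindowDoorLrcModEntireJetCertPsatzElimHStage

variable {n : ℕ}

/-- **STAGED REPLAY, pre-tested variant**: run a list of steps from the state `(hyps, pins)` with exactly the side conditions and state updates of
the `elim` / `force` branches of `etreeCheckI` (gauge letters and sign conditions empty); `none` as soon as a side condition fails. [folklore] -/
def runI (n g : ℕ) : List HStep → List QMvPoly → List QMvPoly → Option (List QMvPoly × List QMvPoly)
  | [], hyps, pins => some (hyps, pins)
  | (.elim k i κ pe) :: rest, hyps, pins =>
      let L := hyps.getD k []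
      let c := coeffIn i L
      let num := QMvPoly.smul (-1) (restIn i L)
      if decide (i < n) && decide (g < n) && hasVarPin n g pins && decide (κ ≠ 0) && decide (degIn i L ≤ 1) &&
          polyEq c (QMvPoly.smul κ (pinProductN pins pe)) then
        runI n g rest (hyps.map (substStripI n g i num c)) (pins.map (substLawN i num c))
      else none
  | (.force k j κ pe e) :: rest, hyps, pins =>
      if decide (j < n) && decide (κ ≠ 0) && decide (1 ≤ e) &&
          polyEq (hyps.getD k []) (QMvPoly.smul κ (mulN (pinProductN pins pe) (powQN (QMvPoly.var n j) e))) then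
        runI n g rest (hyps ++ [QMvPoly.var n j]) pins
      else none

/-- **SOUNDNESS OF THE STAGED REPLAY (pre-tested variant)**: a real point of the input system (laws `= 0`, pins `≠ 0`) is a real point of the
output system — the SAME point (each `elim` substitutes `c·X_i = num`, which holds at the point; each `force` adjoins `X_j = 0`, which holds at the
point). [folklore] -/
theorem pointDatum_runI (g : ℕ) : ∀ (steps : List HStep) {hyps pins h' p' : List QMvPoly},
    runI n g steps hyps pins = some (h', p') → PointDatum n hyps pins [] [] → PointDatum n h' p' [] [] := by
  intro steps
  induction steps with
  | nil =>
    intro hyps pins h' p' h hd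
    simp only [runI, Option.some.injEq, Prod.mk.injEq] at h
    obtain ⟨rfl, rfl⟩ := h
    exact hd
  | cons s rest ih =>
    intro hyps pins h' p' h hd
    cases s with
    | elim k i κ pe =>
      simp only [runI] at h
      split_ifs at h with hc
      simp only [Bool.and_eq_true, decide_eq_true_eq] at hc
      obtain ⟨⟨⟨⟨⟨hi, hgn⟩, hvp⟩, hκ⟩, hdeg⟩, hcf⟩ := hc
      obtain ⟨z, hh, hp, hz, hq⟩ := hd
      set L := hyps.getD k [] with hL
      set c := coeffIn i L with hc_def
      set num := QMvPoly.smul (-1) (restIn i L) with hnum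
      have hcz : ev n c z ≠ 0 := by
        rw [ev_eq_of_polyEq hcf z, ev_smul, ev_pinProductN]
        exact mul_ne_zero (by exact_mod_cast hκ) (ev_pinProduct_ne_zero z pins pe hp)
      have hLz : ev n L z = 0 := ev_getD_eq_zero hh k
      have hlin := ev_linear_split z ⟨i, hi⟩ L hdeg
      have hzi : ev n c z * z ⟨i, hi⟩ = ev n num z := by
        rw [hnum, ev_smul]; push_cast
        have : z ⟨i, hi⟩ * ev n c z + ev n (restIn i L) z = 0 := by rw [← hLz, hlin]
        linarith
      have hzg : z ⟨g, hgn⟩ ≠ 0 := zg_ne_zero_of_hasVarPin (g := ⟨g, hgn⟩) hvp hp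
      refine ih h ⟨z, ?_, ?_, hz, hq⟩
      · intro L' hL'
        obtain ⟨P, hP, rfl⟩ := List.mem_map.1 hL'
        exact ev_substStripI_eq_zero z ⟨g, hgn⟩ ⟨i, hi⟩ num c hzg hzi (hh P hP)
      · intro π' hπ'
        obtain ⟨P, hP, rfl⟩ := List.mem_map.1 hπ'
        exact ev_substLawN_ne_zero z ⟨i, hi⟩ num c hzi hcz (hp P hP)
    | force k j κ pe e =>
      simp only [runI] at h
      split_ifs at h with hc
      simp only [Bool.and_eq_true, decide_eq_true_eq] at hc
      obtain ⟨⟨⟨hj, hκ⟩, he⟩, hform⟩ := hc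
      obtain ⟨z, hh, hp, hz, hq⟩ := hd
      have hLz : ev n (hyps.getD k []) z = 0 := ev_getD_eq_zero hh k
      rw [ev_eq_of_polyEq hform z, ev_smul, ev_mulN, ev_pinProductN, ev_powQN, ev_var z ⟨j, hj⟩] at hLz
      have hzj : z ⟨j, hj⟩ = 0 := by
        have h1 : (κ : ℝ) ≠ 0 := by exact_mod_cast hκ
        have h2 := ev_pinProduct_ne_zero z pins pe hp
        have h3 : z ⟨j, hj⟩ ^ e = 0 := by
          rcases mul_eq_zero.1 hLz with h | h
          · exact absurd h h1
          · rcases mul_eq_zero.1 h with h' | h'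
            · exact absurd h' h2
            · exact h'
        exact pow_eq_zero_iff (by omega) |>.1 h3
      refine ih h ⟨z, ?_, hp, hz, hq⟩
      intro L hL
      rcases List.mem_append.1 hL with hL' | hL'
      · exact hh L hL'
      · rw [List.mem_singleton.1 hL', ev_var z ⟨j, hj⟩]; exact hzj

/-- **STAGE CHECK (pre-tested variant)** (Boolean): the steps replay from `(hyps, pins)` under `runI` and land on `(h₁, p₁)` up to `polyEq`. [folklore] -/
def stageCheckI (n g : ℕ) (hyps pins : List QMvPoly) (steps : List HStep) (h₁ p₁ : List QMvPoly) : Bool :=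
  match runI n g steps hyps pins with
  | none => false
  | some s => polyListEq s.1 h₁ && polyListEq s.2 p₁

/-- **SOUNDNESS OF A STAGE (pre-tested variant)**: a real point of the stage's input system is a real point of its declared output system. [folklore] -/
theorem pointDatum_of_stageCheckI {g : ℕ} {hyps pins h₁ p₁ : List QMvPoly} {steps : List HStep}
    (h : stageCheckI n g hyps pins steps h₁ p₁ = true) (hd : PointDatum n hyps pins [] []) : PointDatum n h₁ p₁ [] [] := by
  cases hr : runI n g steps hyps pins with
  | none => simp [stageCheckI, hr] at h
  | some s =>
    obtain ⟨s1, s2⟩ := s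
    simp only [stageCheckI, hr, Bool.and_eq_true] at h
    exact pointDatum_of_polyListEq h.1 h.2 (pointDatum_runI g steps hr hd)

/-- **ASSEMBLY OF A STAGED KILL (pre-tested final slice)**: if every real point of `(hyps, pins ++ [Σ_{j∈J} X_j²])` is carried by the stages to a
real point of `(h_K, p_K)`, and the final transcript slice refutes `(h_K, p_K)` under `etreeCheckI`, then every real solution is untwisted — the
statement of `kills_of_killCheckI`, by the same argument.  The chain `hchain` may be assembled from `pointDatum_of_stageCheckI` and/or
`pointDatum_of_stageCheckH` stages. [folklore] -/
theorem kills_of_stagesI {g : ℕ} {hyps pins hK pK : List QMvPoly} {J : List ℕ} {t : ETree}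
    (hchain : PointDatum n hyps (pins ++ [sumSq n J]) [] [] → PointDatum n hK pK [] [])
    (ht : etreeCheckI n g hK pK [] [] t = true) : Kills n hyps pins [] [] J := by
  intro z hh hp hz hq j hjJ hj
  by_contra hne
  refine not_pointDatum_of_etreeCheckI g t ht (hchain ⟨z, hh, ?_, hz, hq⟩)
  intro π hπ
  rcases List.mem_append.1 hπ with h' | h'
  · exact hp π h'
  · rw [List.mem_singleton.1 h', ev_sumSq]
    have hnn : ∀ x ∈ J.map (fun j => ev n (QMvPoly.var n j) z * ev n (QMvPoly.var n j) z), (0 : ℝ) ≤ x := by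
      intro x hx
      obtain ⟨j', -, rfl⟩ := List.mem_map.1 hx
      exact mul_self_nonneg _
    have hmem : ev n (QMvPoly.var n j) z * ev n (QMvPoly.var n j) z ∈
        J.map (fun j => ev n (QMvPoly.var n j) z * ev n (QMvPoly.var n j) z) := List.mem_map.2 ⟨j, hjJ, rfl⟩
    have hle := List.single_le_sum hnn _ hmem
    have hpos : 0 < ev n (QMvPoly.var n j) z * ev n (QMvPoly.var n j) z := by
      rw [ev_var z ⟨j, hj⟩]; exact mul_self_pos.2 hne
    exact ne_of_gt (lt_of_lt_of_le hpos hle)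

/-! ### Self-test (`decide +kernel`): the toy transcript of `…JetCertPsatzElimH`, cut after its first step, in the pre-tested variant -/

/-- Stage 1 of the toy transcript: `elim 0 1 1 [1]` from the toy system lands on the declared state (pre-tested replay). [folklore] -/
theorem example_stage1 :
    stageCheckI 3 0 [[([1, 1, 0], (1 : ℚ)), ([0, 0, 0], (-1 : ℚ)), ([2, 0, 0], (-1 : ℚ))], [([0, 1, 1], (1 : ℚ)), ([1, 0, 1], (-1 : ℚ))]]
      [QMvPoly.var 3 0, sumSq 3 [2]] [.elim 0 1 1 [1]]
      [[], [([0, 0, 1], (1 : ℚ))]] [[([1, 0, 0], (1 : ℚ))], [([0, 0, 2], (1 : ℚ))]] = true := by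
  decide +kernel

/-- Stage 2 (final slice) of the toy transcript replays on the declared state under `etreeCheckI`. [folklore] -/
theorem example_stage2 :
    etreeCheckI 3 0 [[], [([0, 0, 1], (1 : ℚ))]] [[([1, 0, 0], (1 : ℚ))], [([0, 0, 2], (1 : ℚ))]] [] []
      (.force 1 2 1 [] 1 (.elim 2 2 1 [] (.leaf { steps := [], comb := [], e := [0, 1], sos0 := [], sosG := [] }))) = true := by
  decide +kernel

-- The toy kill, assembled from the two pre-tested stages — the same statement `example_killCheckI` /
-- `…ElimHStage.example_kills_staged` certify (an `example`, so the landed toy theorem is not restated).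
example :
    Kills 3 [[([1, 1, 0], (1 : ℚ)), ([0, 0, 0], (-1 : ℚ)), ([2, 0, 0], (-1 : ℚ))], [([0, 1, 1], (1 : ℚ)), ([1, 0, 1], (-1 : ℚ))]]
      [QMvPoly.var 3 0] [] [] [2] :=
  kills_of_stagesI (g := 0) (fun hd => pointDatum_of_stageCheckI example_stage1 hd) example_stage2

-- The same toy kill assembled from a MIXED chain: stage 1 in the `…ElimHStage` variant, final slice pre-tested.
example :
    Kills 3 [[([1, 1, 0], (1 : ℚ)), ([0, 0, 0], (-1 : ℚ)), ([2, 0, 0], (-1 : ℚ))], [([0, 1, 1], (1 : ℚ)), ([1, 0, 1], (-1 : ℚ))]]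
      [QMvPoly.var 3 0] [] [] [2] :=
  kills_of_stagesI (g := 0)
    (fun hd => pointDatum_of_stageCheckH
      Summit.NavierStokesRegularity.NavierStokesRegularity.Theorems.PoloidalWindowDoorLrcModEntireJetCertPsatzElimHStage.example_stage1 hd)
    example_stage2

end Summit.NavierStokesRegularity.NavierStokesRegularity.Theorems.PoloidalWindowDoorLrcModEntireJetCertPsatzElimIStage

end
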